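import Summits.AtomisticToContinuum.Crystallization.Theses.PricedLinkCensus
import Summits.AtomisticToContinuum.Crystallization.Theorems.PricedLinkCensusStackingHingeOfSupportCore
import Summits.AtomisticToContinuum.Crystallization.Theorems.PalmUnimodularRigidityLayeredLawsSelectHcpDefs
import Summits.AtomisticToContinuum.Crystallization.Theorems.ReggeStarCoercivityDefectFreeCrystallizesExactSelectionLaw
import Summits.AtomisticToContinuum.Crystallization.Theorems.PricedLinkCensusStackingHingeIdealStarRigidity
import Summits.AtomisticToContinuum.Crystallization.Theorems.PricedLinkCensusStackingHingeRelaxedStarRigidity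
import Literature.Geometry.DiscreteGeometry.KissingPatterns
import Literature.Probability.Process.PointStationaryLaw

/-!
# Crux `PricedLinkCensus.StackingHinge` (stmt-AtomisticToContinuum-14993) from EXACT TWO-TYPE ROOT STARS (line `Sketch`, RESHAPE 12, lead c5)

THE WORD-BLIND CUT.  The support core of skeleton v32 (`PricedHcpWindowsSupportCore.stub_gscpOfSupportCore`, landed p145881:
"rotated relaxed hcp lies in the support of every minimising everywhere-good point-stationary hard-core law") is derived here from
the weaker-looking, WORD-BLIND law-level statement `ExactStars` (the registered stub `stub_slpLawExactStars` of `Lines/Sketch.lean`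
v35, hypothesis `hES` below, verbatim): a minimising everywhere-good law has, almost surely, an EXACT root star of one of the two
reference types — the punctured `5/4`-ball of the configuration is a rotated copy of the relaxed-hcp star `refStar a₀ h₀` or of the
regular cuboctahedron `a₀ • fccKissingPattern`.  Word selection is NOT in that statement; it is supplied by landed theorems:

1. Aldous–Lyons "everything shows at the root" (`ae_forall_map_sub_of_ae`, no measurability needed; hard-core configurations are
   locally finite) carries the exact root star to EVERY point of the configuration;
2. chart-free exact-star RIGIDITY (`exactStarRigidity`, from the landed `PricedHcpWindowsIdealStarRigidity.stub_idealStarRigidity`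
   p164240 — ideal ratio, Hales's layer theorem `HalesDSP_layerPackings_holds` — and `PricedHcpWindowsRelaxedStarRigidity.stub_relaxedStarRigidity`
   p168022 — non-ideal ratio: types do not mix, the layer normal propagates, stretch to the ideal ratio, Hales, covering radius):
   everywhere-exact two-type stars on a set through `0` ⇒ an exact rotated Barlow stacking `A '' barlowStacking a₀ h s'`,
   `h ∈ {h₀, a₀√(2/3)}`;
3. SELECTION AT EXACT GEOMETRY (`PalmGoodLaw.ExactSelectionLaw.stub_exactSelectionLaw`, landed by crux 13603's line
   `exact-star-shortcut`: the site column `J₃ − J₂ > 0` p141765 + `tube_hcpE_unique_minimiser` p116871): a point-stationary law a.s.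
   carried by such exact stackings with `E_P[h] ≤ hcpE a₀ h₀` is a.s. `count|(A '' hcpStacking a₀ h₀)`;
4. an almost-sure event of a probability law is non-null, and an exact rotated net is two-way `θ`-matched at every `(R, θ)`.

Main results: `supportCore_of_exactStars : ExactStars → SupportCore` and the ONE-LINE CLOSER
`stub_stackingHingeOfExactStars = stackingHinge_of_exactStars : ExactStars → StackingHinge` (registered glue stub of the skeleton, verbatim).  All `[folklore]`.
-/

noncomputable section

namespace Summit.AtomisticToContinuum.Crystallization.Theorems.PricedHcpWindowsExactStars

open Literature.MathematicalPhysics.StatisticalMechanics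
open Literature.Geometry.DiscreteGeometry
open Literature.Probability.Process
open Summit.AtomisticToContinuum.Crystallization.Theses.PricedLinkCensus
open Summit.AtomisticToContinuum.Crystallization.Theorems
open Summit.AtomisticToContinuum.Crystallization.Theorems.PalmUnimodularRigidity
  (ae_forall_map_sub_of_ae count_restrict_floorNorm_preimage_lt_top)
open Summit.AtomisticToContinuum.Crystallization.Theorems.PricedHcpWindowsAllPointsOfRoot (eq_of_count_restrict_eq)
open Filter Topology MeasureTheory Set

/-- **Exact-star rigidity, both ratios**: if `0 ∈ S` and every point of `S` has an exact two-type star (punctured `5/4`-ball of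
`S − x` = rotated `refStar a₀ h₀` or rotated `a₀ • fccKissingPattern`), then `S` is an exact rotated Barlow stacking with layer
spacing `h₀` or `a₀√(2/3)` — `em` on the ratio, then the landed `stub_idealStarRigidity` / `stub_relaxedStarRigidity`. [folklore] -/
theorem exactStarRigidity : ∀ a₀ h₀ : ℝ, 189 / 200 ≤ a₀ → a₀ ≤ 199 / 200 → 77 / 100 ≤ h₀ → h₀ ≤ 163 / 200 → ∀ S : Set (EuclideanSpace ℝ (Fin 3)), (0 : EuclideanSpace ℝ (Fin 3)) ∈ S → (∀ x ∈ S, ∃ A : EuclideanSpace ℝ (Fin 3) ≃ₗᵢ[ℝ] EuclideanSpace ℝ (Fin 3), ({y : EuclideanSpace ℝ (Fin 3) | y ∈ ((fun p : EuclideanSpace ℝ (Fin 3) => p - x) '' S) ∧ y ≠ 0 ∧ ‖y‖ ≤ 5 / 4} = A '' (↑(Summit.AtomisticToContinuum.Crystallization.Theorems.PalmUnimodularRigidity.LayeredLawsSelectHcp.refStar a₀ h₀) : Set (EuclideanSpace ℝ (Fin 3))) ∨ {y : EuclideanSpace ℝ (Fin 3) | y ∈ ((fun p : EuclideanSpace ℝ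 (Fin 3) => p - x) '' S) ∧ y ≠ 0 ∧ ‖y‖ ≤ 5 / 4} = A '' ((fun p : EuclideanSpace ℝ (Fin 3) => a₀ • p) '' (↑Literature.Geometry.DiscreteGeometry.fccKissingPattern : Set (EuclideanSpace ℝ (Fin 3)))))) → ∃ A : EuclideanSpace ℝ (Fin 3) ≃ₗᵢ[ℝ] EuclideanSpace ℝ (Fin 3), ∃ h : ℝ, (h = h₀ ∨ h = a₀ * Real.sqrt (2 / 3)) ∧ ∃ s' : ℤ → ℤ, Literature.MathematicalPhysics.StatisticalMechanics.IsHaggSeq s' ∧ S = A '' Literature.MathematicalPhysics.StatisticalMechanics.barlowStacking a₀ h s' := by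
  intro a₀ h₀ hb1 hb2 hb3 hb4 S h0 hS
  rcases em (h₀ = a₀ * Real.sqrt (2 / 3)) with hid | hnid
  · exact PricedHcpWindowsIdealStarRigidity.stub_idealStarRigidity a₀ h₀ hb1 hb2 hb3 hb4 hid S h0 hS
  · exact PricedHcpWindowsRelaxedStarRigidity.stub_relaxedStarRigidity a₀ h₀ hb1 hb2 hb3 hb4 hnid S h0 hS

/-- **The support core from exact stars.**  EXACT TWO-TYPE ROOT STARS a.s. for minimising everywhere-good laws (`ExactStars`, the
hypothesis `hES` — verbatim the registered stub `stub_slpLawExactStars` of `Lines/Sketch.lean` v36; it does not take the a.s. local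
Barlow structure as a hypothesis, that being a landed CONSEQUENCE of everywhere-goodness, `lawLocalStructure_holds`) imply v32's
SUPPORT CORE (the conclusion, verbatim the statement of v32's `stub_slpLawSupportCore`): Aldous–Lyons to every point,
`exactStarRigidity`, selection at exact geometry (`PalmGoodLaw.ExactSelectionLaw.stub_exactSelectionLaw`), and "an a.s. exact rotated
net charges the support event at every `(R, θ)`". [folklore] -/
theorem supportCore_of_exactStars : (∀ a₀ h₀ : ℝ, 189 / 200 ≤ a₀ → a₀ ≤ 199 / 200 → 77 / 100 ≤ h₀ → h₀ ≤ 163 / 200 → (∀ a h : ℝ, 0 < a → 0 < h → Summit.AtomisticToContinuum.Crystallization.Theorems.PalmUnimodularRigidity.LayeredLawsSelectHcp.hcpE a₀ h₀ ≤ Summit.AtomisticToContinuum.Crystallization.Theorems.PalmUnimodularRigidity.LayeredLawsSelectHcp.hcpE a h) → ∀ δ : ℝ, 0 < δ → ∀ P : MeasureTheory.Measure (MeasureTheory.Measure (EuclideanSpace ℝ (Fin 3))), MeasureTheory.IsProbabilityMeasure P → (∀ᵐ μ ∂P, (∃ S : Set (EuclideanSpace ℝ (Fin 3)), (0 : EuclideanSpace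 ℝ (Fin 3)) ∈ S ∧ (∀ x ∈ S, ∀ y ∈ S, x ≠ y → δ ≤ dist x y) ∧ μ = (MeasureTheory.Measure.count : MeasureTheory.Measure (EuclideanSpace ℝ (Fin 3))).restrict S)) → (∀ g : MeasureTheory.Measure (EuclideanSpace ℝ (Fin 3)) → EuclideanSpace ℝ (Fin 3) → ENNReal, Measurable (Function.uncurry g) → ∫⁻ μ, ∫⁻ y, g μ y ∂μ ∂P = ∫⁻ μ, ∫⁻ y, g (MeasureTheory.Measure.map (fun z => z - y) μ) (-y) ∂μ ∂P) → (∀ᵐ μ ∂P, ∃ S : Set (EuclideanSpace ℝ (Fin 3)), μ = (MeasureTheory.Measure.count : MeasureTheory.Measure (EuclideanSpace ℝ (Fin 3))).restrict S ∧ ∀ x ∈ S, (∀ t r : ℝ, Metric.infDist x (S \ {x}) / 6 < t → r < 3 * Metric.infDist x (S \ {x}) → ∃ s : ℤ → ℤ, Literature.MathematicalPhysics.StatisticalMechanics.IsHaggSeq s ∧ ∃ g : EuclideanSpace ℝ (Fin 3) ≃ᵃⁱ[ℝ] EuclideanSpace ℝ (Fin 3), (∀ y ∈ S, dist x y ≤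 r → ∃ z ∈ Literature.MathematicalPhysics.StatisticalMechanics.barlowStacking (Metric.infDist x (S \ {x})) (Metric.infDist x (S \ {x}) * Real.sqrt (2 / 3)) s, dist y (g z) ≤ t) ∧ (∀ z ∈ Literature.MathematicalPhysics.StatisticalMechanics.barlowStacking (Metric.infDist x (S \ {x})) (Metric.infDist x (S \ {x}) * Real.sqrt (2 / 3)) s, dist x (g z) ≤ r → ∃ y ∈ S, dist y (g z) ≤ t)) ∧ ((∀ y ∈ S, y ≠ x → dist x y < 107 / 100 * Metric.infDist x (S \ {x}) → dist x y ≤ 101 / 100 * Metric.infDist x (S \ {x})) ∧ ∃ T : Finset (EuclideanSpace ℝ (Fin 3)), (↑T : Set (EuclideanSpace ℝ (Fin 3))) ⊆ {y : EuclideanSpace ℝ (Fin 3) | y ∈ S ∧ y ≠ x ∧ dist x y ≤ 101 / 100 * Metric.infDist x (S \ {x})} ∧ T.card = 12)) → (∫ μ, (∫ y, Literature.MathematicalPhysics.StatisticalMechanics.lennardJones ‖y‖ ∂μ) / 2 ∂P) ≤ Summit.AtomisticToContinuum.Crystallization.Theorems.PalmUnimodularRigidity.LayeredLawsSelectHcp.hcpE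 a₀ h₀ → (∀ Q : Literature.MathematicalPhysics.StatisticalMechanics.PeriodicConfiguration 3, (∫ μ, (∫ y, Literature.MathematicalPhysics.StatisticalMechanics.lennardJones ‖y‖ ∂μ) / 2 ∂P) ≤ Q.energyPerParticle Literature.MathematicalPhysics.StatisticalMechanics.lennardJones) → ∀ᵐ μ ∂P, ∃ S : Set (EuclideanSpace ℝ (Fin 3)), μ = (MeasureTheory.Measure.count : MeasureTheory.Measure (EuclideanSpace ℝ (Fin 3))).restrict S ∧ ∃ A : EuclideanSpace ℝ (Fin 3) ≃ₗᵢ[ℝ] EuclideanSpace ℝ (Fin 3), ({y : EuclideanSpace ℝ (Fin 3) | y ∈ S ∧ y ≠ 0 ∧ ‖y‖ ≤ 5 / 4} = A '' (↑(Summit.AtomisticToContinuum.Crystallization.Theorems.PalmUnimodularRigidity.LayeredLawsSelectHcp.refStar a₀ h₀) : Set (EuclideanSpace ℝ (Fin 3))) ∨ {y : EuclideanSpace ℝ (Fin 3) | y ∈ S ∧ y ≠ 0 ∧ ‖y‖ ≤ 5 / 4} = A '' ((fun p : EuclideanSpace ℝ (Fin 3) => a₀ • p) '' (↑Literature.Geometry.DiscreteGeometry.fccKissingPattern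 : Set (EuclideanSpace ℝ (Fin 3)))))) → (∀ a₀ h₀ : ℝ, 189 / 200 ≤ a₀ → a₀ ≤ 199 / 200 → 77 / 100 ≤ h₀ → h₀ ≤ 163 / 200 → (∀ a h : ℝ, 0 < a → 0 < h → Summit.AtomisticToContinuum.Crystallization.Theorems.PalmUnimodularRigidity.LayeredLawsSelectHcp.hcpE a₀ h₀ ≤ Summit.AtomisticToContinuum.Crystallization.Theorems.PalmUnimodularRigidity.LayeredLawsSelectHcp.hcpE a h) → ∀ δ : ℝ, 0 < δ → ∀ P : MeasureTheory.Measure (MeasureTheory.Measure (EuclideanSpace ℝ (Fin 3))), MeasureTheory.IsProbabilityMeasure P → (∀ᵐ μ ∂P, (∃ S : Set (EuclideanSpace ℝ (Fin 3)), (0 : EuclideanSpace ℝ (Fin 3)) ∈ S ∧ (∀ x ∈ S, ∀ y ∈ S, x ≠ y → δ ≤ dist x y) ∧ μ = (MeasureTheory.Measure.count : MeasureTheory.Measure (EuclideanSpace ℝ (Fin 3))).restrict S)) → (∀ g : MeasureTheory.Measure (EuclideanSpace ℝ (Fin 3)) → EuclideanSpace ℝ (Fin 3) → ENNReal, Measurable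 (Function.uncurry g) → ∫⁻ μ, ∫⁻ y, g μ y ∂μ ∂P = ∫⁻ μ, ∫⁻ y, g (MeasureTheory.Measure.map (fun z => z - y) μ) (-y) ∂μ ∂P) → (∀ᵐ μ ∂P, ∃ S : Set (EuclideanSpace ℝ (Fin 3)), μ = (MeasureTheory.Measure.count : MeasureTheory.Measure (EuclideanSpace ℝ (Fin 3))).restrict S ∧ ∀ x ∈ S, (∀ t r : ℝ, Metric.infDist x (S \ {x}) / 6 < t → r < 3 * Metric.infDist x (S \ {x}) → ∃ s : ℤ → ℤ, Literature.MathematicalPhysics.StatisticalMechanics.IsHaggSeq s ∧ ∃ g : EuclideanSpace ℝ (Fin 3) ≃ᵃⁱ[ℝ] EuclideanSpace ℝ (Fin 3), (∀ y ∈ S, dist x y ≤ r → ∃ z ∈ Literature.MathematicalPhysics.StatisticalMechanics.barlowStacking (Metric.infDist x (S \ {x})) (Metric.infDist x (S \ {x}) * Real.sqrt (2 / 3)) s, dist y (g z) ≤ t) ∧ (∀ z ∈ Literature.MathematicalPhysics.StatisticalMechanics.barlowStacking (Metric.infDist x (S \ {x})) (Metric.infDist x (S \ {x}) * Real.sqrt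 (2 / 3)) s, dist x (g z) ≤ r → ∃ y ∈ S, dist y (g z) ≤ t)) ∧ ((∀ y ∈ S, y ≠ x → dist x y < 107 / 100 * Metric.infDist x (S \ {x}) → dist x y ≤ 101 / 100 * Metric.infDist x (S \ {x})) ∧ ∃ T : Finset (EuclideanSpace ℝ (Fin 3)), (↑T : Set (EuclideanSpace ℝ (Fin 3))) ⊆ {y : EuclideanSpace ℝ (Fin 3) | y ∈ S ∧ y ≠ x ∧ dist x y ≤ 101 / 100 * Metric.infDist x (S \ {x})} ∧ T.card = 12)) → (∀ᵐ μ ∂P, ∃ S : Set (EuclideanSpace ℝ (Fin 3)), μ = (MeasureTheory.Measure.count : MeasureTheory.Measure (EuclideanSpace ℝ (Fin 3))).restrict S ∧ ∀ x ∈ S, ((∀ y ∈ S, dist x y ≤ 2 * Metric.infDist x (S \ {x}) → 13 / 20 * Metric.infDist x (S \ {x}) ≤ Metric.infDist y (S \ {y})) ∧ (∀ y ∈ S, y ≠ x → dist x y ≤ 101 / 100 * Metric.infDist x (S \ {x}) → dist x y ≤ 101 / 100 * Metric.infDist y (S \ {y})) ∧ ({y : EuclideanSpace ℝ (Fin 3)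 | y ∈ S ∧ y ≠ x ∧ dist x y ≤ 101 / 100 * Metric.infDist x (S \ {x})}.ncard = 12) ∧ (∀ t r : ℝ, Metric.infDist x (S \ {x}) / 6 < t → t ≤ 7 / 40 * Metric.infDist x (S \ {x}) → 29 / 10 * Metric.infDist x (S \ {x}) ≤ r → ∀ (s : ℤ → ℤ) (g : EuclideanSpace ℝ (Fin 3) ≃ᵃⁱ[ℝ] EuclideanSpace ℝ (Fin 3)), Literature.MathematicalPhysics.StatisticalMechanics.IsHaggSeq s → (∀ y ∈ S, dist x y ≤ r → ∃ z ∈ Literature.MathematicalPhysics.StatisticalMechanics.barlowStacking (Metric.infDist x (S \ {x})) (Metric.infDist x (S \ {x}) * Real.sqrt (2 / 3)) s, dist y (g z) ≤ t) → (∀ z ∈ Literature.MathematicalPhysics.StatisticalMechanics.barlowStacking (Metric.infDist x (S \ {x})) (Metric.infDist x (S \ {x}) * Real.sqrt (2 / 3)) s, dist x (g z) ≤ r → ∃ y ∈ S, dist y (g z) ≤ t) → ∀ y ∈ S, ∀ y' ∈ S, y ≠ x → dist x y ≤ 101 / 100 * Metric.infDist x (S \ {x}) → y' ≠ x → dist x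 y' ≤ 101 / 100 * Metric.infDist x (S \ {x}) → y ≠ y' → ∀ z ∈ Literature.MathematicalPhysics.StatisticalMechanics.barlowStacking (Metric.infDist x (S \ {x})) (Metric.infDist x (S \ {x}) * Real.sqrt (2 / 3)) s, ∀ z' ∈ Literature.MathematicalPhysics.StatisticalMechanics.barlowStacking (Metric.infDist x (S \ {x})) (Metric.infDist x (S \ {x}) * Real.sqrt (2 / 3)) s, dist y (g z) ≤ t → dist y' (g z') ≤ t → (dist y y' ≤ 101 / 100 * Metric.infDist y (S \ {y}) ↔ dist z z' = Metric.infDist x (S \ {x}))))) → (∫ μ, (∫ y, Literature.MathematicalPhysics.StatisticalMechanics.lennardJones ‖y‖ ∂μ) / 2 ∂P) ≤ Summit.AtomisticToContinuum.Crystallization.Theorems.PalmUnimodularRigidity.LayeredLawsSelectHcp.hcpE a₀ h₀ → (∀ Q : Literature.MathematicalPhysics.StatisticalMechanics.PeriodicConfiguration 3, (∫ μ, (∫ y, Literature.MathematicalPhysics.StatisticalMechanics.lennardJones ‖y‖ ∂μ) / 2 ∂P) ≤ Q.energyPerParticle Literature.MathematicalPhysics.StatisticalMechanics.lennardJones) →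 ∀ R θ : ℝ, 0 < R → 0 < θ → P {μ | ∃ S : Set (EuclideanSpace ℝ (Fin 3)), μ = (MeasureTheory.Measure.count : MeasureTheory.Measure (EuclideanSpace ℝ (Fin 3))).restrict S ∧ ∃ A : EuclideanSpace ℝ (Fin 3) ≃ₗᵢ[ℝ] EuclideanSpace ℝ (Fin 3), (∀ y ∈ S, ‖y‖ ≤ R → ∃ z ∈ Literature.MathematicalPhysics.StatisticalMechanics.hcpStacking a₀ h₀, dist y (A z) ≤ θ) ∧ (∀ z ∈ Literature.MathematicalPhysics.StatisticalMechanics.hcpStacking a₀ h₀, ‖z‖ ≤ R → ∃ y ∈ S, dist y (A z) ≤ θ)} ≠ 0) := by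
  intro hES a₀ h₀ hb1 hb2 hb3 hb4 hglob δ hδ P hP hcore hstat hgood _hLS hle hper R θ _hR hθ
  -- a.s. the root star is exact (two types)
  have hroot := hES a₀ h₀ hb1 hb2 hb3 hb4 hglob δ hδ P hP hcore hstat hgood hle hper
  -- hard-core configurations are locally finite
  have hlf : ∀ᵐ μ ∂P, ∀ n : ℕ,
      μ ((fun z : EuclideanSpace ℝ (Fin 3) => ⌊‖z‖⌋₊) ⁻¹' {n}) < ⊤ := by
    filter_upwards [hcore] with μ hμ n
    obtain ⟨S, -, hsep, rfl⟩ := hμ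
    exact count_restrict_floorNorm_preimage_lt_top hδ hsep n
  -- everything shows at the root: a.s. EVERY point has an exact two-type star
  have hall := ae_forall_map_sub_of_ae hstat hlf hroot
  -- hence a.s. the configuration is an exact rotated Barlow stacking with `h ∈ {h₀, a₀√(2/3)}`
  have hbarlow : ∀ᵐ μ ∂P, ∃ A : EuclideanSpace ℝ (Fin 3) ≃ₗᵢ[ℝ] EuclideanSpace ℝ (Fin 3), ∃ h : ℝ,
      (h = h₀ ∨ h = a₀ * Real.sqrt (2 / 3)) ∧ ∃ s : ℤ → ℤ,
        Literature.MathematicalPhysics.StatisticalMechanics.IsHaggSeq s ∧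
          μ = (MeasureTheory.Measure.count : MeasureTheory.Measure (EuclideanSpace ℝ (Fin 3))).restrict
            (A '' Literature.MathematicalPhysics.StatisticalMechanics.barlowStacking a₀ h s) := by
    filter_upwards [hcore, hall] with μ hc ha
    obtain ⟨S, hS0, -, rfl⟩ := hc
    have hS : ∀ x ∈ S, ∃ A : EuclideanSpace ℝ (Fin 3) ≃ₗᵢ[ℝ] EuclideanSpace ℝ (Fin 3),
        ({y : EuclideanSpace ℝ (Fin 3) | y ∈ ((fun p : EuclideanSpace ℝ (Fin 3) => p - x) '' S) ∧ y ≠ 0 ∧ ‖y‖ ≤ 5 / 4} =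
            A '' (↑(Summit.AtomisticToContinuum.Crystallization.Theorems.PalmUnimodularRigidity.LayeredLawsSelectHcp.refStar a₀ h₀) :
              Set (EuclideanSpace ℝ (Fin 3))) ∨
          {y : EuclideanSpace ℝ (Fin 3) | y ∈ ((fun p : EuclideanSpace ℝ (Fin 3) => p - x) '' S) ∧ y ≠ 0 ∧ ‖y‖ ≤ 5 / 4} =
            A '' ((fun p : EuclideanSpace ℝ (Fin 3) => a₀ • p) ''
              (↑Literature.Geometry.DiscreteGeometry.fccKissingPattern : Set (EuclideanSpace ℝ (Fin 3))))) := by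
      intro x hx
      obtain ⟨S', hS', hwin⟩ := ha x ((count_restrict_singleton_ne_zero_iff S x).2 hx)
      rw [map_sub_count_restrict] at hS'
      obtain rfl := eq_of_count_restrict_eq hS'
      exact hwin
    obtain ⟨A, h, hh, s', hs', hSeq⟩ := exactStarRigidity a₀ h₀ hb1 hb2 hb3 hb4 S hS0 hS
    exact ⟨A, h, hh, s', hs', by rw [← hSeq]⟩
  -- selection at exact geometry: a.s. an exact rotated `hcpStacking a₀ h₀`
  have hexact : ∀ᵐ μ ∂P, ∃ A : EuclideanSpace ℝ (Fin 3) ≃ₗᵢ[ℝ] EuclideanSpace ℝ (Fin 3),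
      μ = (MeasureTheory.Measure.count : MeasureTheory.Measure (EuclideanSpace ℝ (Fin 3))).restrict
        (A '' Literature.MathematicalPhysics.StatisticalMechanics.hcpStacking a₀ h₀) :=
    PalmGoodLaw.ExactSelectionLaw.stub_exactSelectionLaw a₀ h₀ hb1 hb2 hb3 hb4 hglob δ hδ P hP hcore hstat hle hbarlow
  -- an a.s. event has non-zero measure; an exact rotated net is matched at every `(R, θ)`
  intro h0
  have hnot : ∀ᵐ μ ∂P, μ ∉ {μ | ∃ S : Set (EuclideanSpace ℝ (Fin 3)), μ = (MeasureTheory.Measure.count : MeasureTheory.Measure (EuclideanSpace ℝ (Fin 3))).restrict S ∧ ∃ A : EuclideanSpace ℝ (Fin 3) ≃ₗᵢ[ℝ] EuclideanSpace ℝ (Fin 3), (∀ y ∈ S, ‖y‖ ≤ R → ∃ z ∈ Literature.MathematicalPhysics.StatisticalMechanics.hcpStacking a₀ h₀, dist y (A z) ≤ θ) ∧ (∀ z ∈ Literature.MathematicalPhysics.StatisticalMechanics.hcpStacking a₀ h₀, ‖z‖ ≤ R → ∃ y ∈ S, dist y (A z) ≤ θ)} :=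
    (MeasureTheory.measure_eq_zero_iff_ae_notMem).1 h0
  haveI : (MeasureTheory.ae P).NeBot := MeasureTheory.ae_neBot.2 (IsProbabilityMeasure.ne_zero P)
  obtain ⟨μ, ⟨A, rfl⟩, hμ⟩ := (hexact.and hnot).exists
  refine hμ ⟨A '' Literature.MathematicalPhysics.StatisticalMechanics.hcpStacking a₀ h₀, rfl, A, ?_, ?_⟩
  · rintro y ⟨z, hz, rfl⟩ _
    exact ⟨z, hz, by simp [hθ.le]⟩
  · intro z hz _
    exact ⟨A z, ⟨z, hz, rfl⟩, by simp [hθ.le]⟩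

/-- **stub_stackingHingeOfExactStars** — THE ONE-LINE CLOSER from exact stars (registered glue stub of `Lines/Sketch.lean` v36,
verbatim): `ExactStars → SoftLayerPropagation → ChargeFreeWindows → GroundStatesChargePeriodic` (the crux with its definition unfolded),
by `supportCore_of_exactStars` and the landed `PricedHcpWindowsSupportCore.stub_gscpOfSupportCore` (p145881). [folklore] -/
theorem stub_stackingHingeOfExactStars : (∀ a₀ h₀ : ℝ, 189 / 200 ≤ a₀ → a₀ ≤ 199 / 200 → 77 / 100 ≤ h₀ → h₀ ≤ 163 / 200 → (∀ a h : ℝ, 0 < a → 0 < h → Summit.AtomisticToContinuum.Crystallization.Theorems.PalmUnimodularRigidity.LayeredLawsSelectHcp.hcpE a₀ h₀ ≤ Summit.AtomisticToContinuum.Crystallization.Theorems.PalmUnimodularRigidity.LayeredLawsSelectHcp.hcpE a h) → ∀ δ : ℝ, 0 < δ → ∀ P : MeasureTheory.Measure (MeasureTheory.Measure (EuclideanSpace ℝ (Fin 3))), MeasureTheory.IsProbabilityMeasure P → (∀ᵐ μ ∂P, (∃ S : Set (EuclideanSpace ℝ (Fin 3)), (0 : EuclideanSpace ℝ (Fin 3))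 ∈ S ∧ (∀ x ∈ S, ∀ y ∈ S, x ≠ y → δ ≤ dist x y) ∧ μ = (MeasureTheory.Measure.count : MeasureTheory.Measure (EuclideanSpace ℝ (Fin 3))).restrict S)) → (∀ g : MeasureTheory.Measure (EuclideanSpace ℝ (Fin 3)) → EuclideanSpace ℝ (Fin 3) → ENNReal, Measurable (Function.uncurry g) → ∫⁻ μ, ∫⁻ y, g μ y ∂μ ∂P = ∫⁻ μ, ∫⁻ y, g (MeasureTheory.Measure.map (fun z => z - y) μ) (-y) ∂μ ∂P) → (∀ᵐ μ ∂P, ∃ S : Set (EuclideanSpace ℝ (Fin 3)), μ = (MeasureTheory.Measure.count : MeasureTheory.Measure (EuclideanSpace ℝ (Fin 3))).restrict S ∧ ∀ x ∈ S, (∀ t r : ℝ, Metric.infDist x (S \ {x}) / 6 < t → r < 3 * Metric.infDist x (S \ {x}) → ∃ s : ℤ → ℤ, Literature.MathematicalPhysics.StatisticalMechanics.IsHaggSeq s ∧ ∃ g : EuclideanSpace ℝ (Fin 3) ≃ᵃⁱ[ℝ] EuclideanSpace ℝ (Fin 3), (∀ y ∈ S, dist x y ≤ r → ∃ z ∈ Literature.MathematicalPhysics.StatisticalMechanics.barlowStacking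 (Metric.infDist x (S \ {x})) (Metric.infDist x (S \ {x}) * Real.sqrt (2 / 3)) s, dist y (g z) ≤ t) ∧ (∀ z ∈ Literature.MathematicalPhysics.StatisticalMechanics.barlowStacking (Metric.infDist x (S \ {x})) (Metric.infDist x (S \ {x}) * Real.sqrt (2 / 3)) s, dist x (g z) ≤ r → ∃ y ∈ S, dist y (g z) ≤ t)) ∧ ((∀ y ∈ S, y ≠ x → dist x y < 107 / 100 * Metric.infDist x (S \ {x}) → dist x y ≤ 101 / 100 * Metric.infDist x (S \ {x})) ∧ ∃ T : Finset (EuclideanSpace ℝ (Fin 3)), (↑T : Set (EuclideanSpace ℝ (Fin 3))) ⊆ {y : EuclideanSpace ℝ (Fin 3) | y ∈ S ∧ y ≠ x ∧ dist x y ≤ 101 / 100 * Metric.infDist x (S \ {x})} ∧ T.card = 12)) → (∫ μ, (∫ y, Literature.MathematicalPhysics.StatisticalMechanics.lennardJones ‖y‖ ∂μ) / 2 ∂P) ≤ Summit.AtomisticToContinuum.Crystallization.Theorems.PalmUnimodularRigidity.LayeredLawsSelectHcp.hcpE a₀ h₀ → (∀ Q : Literature.MathematicalPhysics.StatisticalMechanics.PeriodicConfiguration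 3, (∫ μ, (∫ y, Literature.MathematicalPhysics.StatisticalMechanics.lennardJones ‖y‖ ∂μ) / 2 ∂P) ≤ Q.energyPerParticle Literature.MathematicalPhysics.StatisticalMechanics.lennardJones) → ∀ᵐ μ ∂P, ∃ S : Set (EuclideanSpace ℝ (Fin 3)), μ = (MeasureTheory.Measure.count : MeasureTheory.Measure (EuclideanSpace ℝ (Fin 3))).restrict S ∧ ∃ A : EuclideanSpace ℝ (Fin 3) ≃ₗᵢ[ℝ] EuclideanSpace ℝ (Fin 3), ({y : EuclideanSpace ℝ (Fin 3) | y ∈ S ∧ y ≠ 0 ∧ ‖y‖ ≤ 5 / 4} = A '' (↑(Summit.AtomisticToContinuum.Crystallization.Theorems.PalmUnimodularRigidity.LayeredLawsSelectHcp.refStar a₀ h₀) : Set (EuclideanSpace ℝ (Fin 3))) ∨ {y : EuclideanSpace ℝ (Fin 3) | y ∈ S ∧ y ≠ 0 ∧ ‖y‖ ≤ 5 / 4} = A '' ((fun p : EuclideanSpace ℝ (Fin 3) => a₀ • p) '' (↑Literature.Geometry.DiscreteGeometry.fccKissingPattern : Set (EuclideanSpace ℝ (Fin 3)))))) → Summit.AtomisticToContinuum.Crystallization.Theses.PricedLinkCensus.SoftLayerPropagation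 → Summit.AtomisticToContinuum.Crystallization.Theses.PricedLinkCensus.ChargeFreeWindows → Summit.AtomisticToContinuum.Crystallization.Theses.PricedLinkCensus.GroundStatesChargePeriodic :=
  fun hES => PricedHcpWindowsSupportCore.stub_gscpOfSupportCore (supportCore_of_exactStars hES)

/-- Alias with the line's naming convention: `ExactStars → StackingHinge`. [folklore] -/
theorem stackingHinge_of_exactStars : (∀ a₀ h₀ : ℝ, 189 / 200 ≤ a₀ → a₀ ≤ 199 / 200 → 77 / 100 ≤ h₀ → h₀ ≤ 163 / 200 → (∀ a h : ℝ, 0 < a → 0 < h → Summit.AtomisticToContinuum.Crystallization.Theorems.PalmUnimodularRigidity.LayeredLawsSelectHcp.hcpE a₀ h₀ ≤ Summit.AtomisticToContinuum.Crystallization.Theorems.PalmUnimodularRigidity.LayeredLawsSelectHcp.hcpE a h) → ∀ δ : ℝ, 0 < δ → ∀ P : MeasureTheory.Measure (MeasureTheory.Measure (EuclideanSpace ℝ (Fin 3))), MeasureTheory.IsProbabilityMeasure P → (∀ᵐ μ ∂P, (∃ S : Set (EuclideanSpace ℝ (Fin 3)), (0 : EuclideanSpace ℝ (Fin 3)) ∈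 S ∧ (∀ x ∈ S, ∀ y ∈ S, x ≠ y → δ ≤ dist x y) ∧ μ = (MeasureTheory.Measure.count : MeasureTheory.Measure (EuclideanSpace ℝ (Fin 3))).restrict S)) → (∀ g : MeasureTheory.Measure (EuclideanSpace ℝ (Fin 3)) → EuclideanSpace ℝ (Fin 3) → ENNReal, Measurable (Function.uncurry g) → ∫⁻ μ, ∫⁻ y, g μ y ∂μ ∂P = ∫⁻ μ, ∫⁻ y, g (MeasureTheory.Measure.map (fun z => z - y) μ) (-y) ∂μ ∂P) → (∀ᵐ μ ∂P, ∃ S : Set (EuclideanSpace ℝ (Fin 3)), μ = (MeasureTheory.Measure.count : MeasureTheory.Measure (EuclideanSpace ℝ (Fin 3))).restrict S ∧ ∀ x ∈ S, (∀ t r : ℝ, Metric.infDist x (S \ {x}) / 6 < t → r < 3 * Metric.infDist x (S \ {x}) → ∃ s : ℤ → ℤ, Literature.MathematicalPhysics.StatisticalMechanics.IsHaggSeq s ∧ ∃ g : EuclideanSpace ℝ (Fin 3) ≃ᵃⁱ[ℝ] EuclideanSpace ℝ (Fin 3), (∀ y ∈ S, dist x y ≤ r → ∃ z ∈ Literature.MathematicalPhysics.StatisticalMechanics.barlowStacking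 (Metric.infDist x (S \ {x})) (Metric.infDist x (S \ {x}) * Real.sqrt (2 / 3)) s, dist y (g z) ≤ t) ∧ (∀ z ∈ Literature.MathematicalPhysics.StatisticalMechanics.barlowStacking (Metric.infDist x (S \ {x})) (Metric.infDist x (S \ {x}) * Real.sqrt (2 / 3)) s, dist x (g z) ≤ r → ∃ y ∈ S, dist y (g z) ≤ t)) ∧ ((∀ y ∈ S, y ≠ x → dist x y < 107 / 100 * Metric.infDist x (S \ {x}) → dist x y ≤ 101 / 100 * Metric.infDist x (S \ {x})) ∧ ∃ T : Finset (EuclideanSpace ℝ (Fin 3)), (↑T : Set (EuclideanSpace ℝ (Fin 3))) ⊆ {y : EuclideanSpace ℝ (Fin 3) | y ∈ S ∧ y ≠ x ∧ dist x y ≤ 101 / 100 * Metric.infDist x (S \ {x})} ∧ T.card = 12)) → (∫ μ, (∫ y, Literature.MathematicalPhysics.StatisticalMechanics.lennardJones ‖y‖ ∂μ) / 2 ∂P) ≤ Summit.AtomisticToContinuum.Crystallization.Theorems.PalmUnimodularRigidity.LayeredLawsSelectHcp.hcpE a₀ h₀ → (∀ Q : Literature.MathematicalPhysics.StatisticalMechanics.PeriodicConfiguration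 3, (∫ μ, (∫ y, Literature.MathematicalPhysics.StatisticalMechanics.lennardJones ‖y‖ ∂μ) / 2 ∂P) ≤ Q.energyPerParticle Literature.MathematicalPhysics.StatisticalMechanics.lennardJones) → ∀ᵐ μ ∂P, ∃ S : Set (EuclideanSpace ℝ (Fin 3)), μ = (MeasureTheory.Measure.count : MeasureTheory.Measure (EuclideanSpace ℝ (Fin 3))).restrict S ∧ ∃ A : EuclideanSpace ℝ (Fin 3) ≃ₗᵢ[ℝ] EuclideanSpace ℝ (Fin 3), ({y : EuclideanSpace ℝ (Fin 3) | y ∈ S ∧ y ≠ 0 ∧ ‖y‖ ≤ 5 / 4} = A '' (↑(Summit.AtomisticToContinuum.Crystallization.Theorems.PalmUnimodularRigidity.LayeredLawsSelectHcp.refStar a₀ h₀) : Set (EuclideanSpace ℝ (Fin 3))) ∨ {y : EuclideanSpace ℝ (Fin 3) | y ∈ S ∧ y ≠ 0 ∧ ‖y‖ ≤ 5 / 4} = A '' ((fun p : EuclideanSpace ℝ (Fin 3) => a₀ • p) '' (↑Literature.Geometry.DiscreteGeometry.fccKissingPattern : Set (EuclideanSpace ℝ (Fin 3)))))) → Summit.AtomisticToContinuum.Crystallization.Theses.PricedLinkCensus.StackingHinge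 :=
  fun hES hSLP hCFW => stub_stackingHingeOfExactStars hES hSLP hCFW

end Summit.AtomisticToContinuum.Crystallization.Theorems.PricedHcpWindowsExactStars

end
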